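import Literature.NumberTheory.Weil1964.LocalLerayCocycle
import HarnessLib

/-!
# The Leray–Weil index and the Leray cocycle under an isometry between two symplectic spaces

Topic `NumberTheory/Weil1964`; namespace `Literature.NumberTheory.Weil1964`. KERNEL mathematics only (theorems;
no named fact, no `axiom`, no `sorry`). Sequel of `LocalLerayWeilIndex.lean` (`lerayWeilIndex_map`: invariance
under an isometric AUTOMORPHISM of one space) and `LocalLerayCocycle.lean`.

For a linear equivalence `e : V ≃ V'` carrying a bilinear form `B` on `V` to `B'` on `V'`
(`B'(e x, e y) = B(x, y)`):
* §1 `e` maps Lagrangians of `B` to Lagrangians of `B'` (`orthogonal_map_equiv_eq_self`);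
* §2 **`μ_ψ(eℓ₁, eℓ₂, eℓ₃) = μ_ψ(ℓ₁, ℓ₂, ℓ₃)`** (`lerayWeilIndex_map_equiv`): Kashiwara's forms are isometric
  ([LionVergne1980] 1.5.2 "symplectic invariance", stated there for automorphisms; [Rangarao1993] Thm 2.11);
* §3 **`c_{eℓ}(e g₁ e⁻¹, e g₂ e⁻¹) = c_ℓ(g₁, g₂)`** for the Leray cocycles of `(V', B', eℓ)` and `(V, B, ℓ)`
  (`lerayCocycle_conj`) — the cocycle is an invariant of the isomorphism class of the datum `(V, B, ℓ)`
  ([MoeglinVignerasWaldspurger1987] Chap. 3 §I.3, remarque b): "sa classe … ne dépend que de `W`").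
This is the change of variables moving the Leray cocycle of `F^ι ⊕ F^ι` with the standard duality `⟨x, y⟩` to the
duality `⟨x, T y⟩` of a Gram matrix `T` (consumer: `HeisenbergGroup/SchrodingerLeraySectionGram.lean`).

## References

* [LionVergne1980] G. Lion, M. Vergne, *The Weil representation, Maslov index and theta series*, Progress in
  Math. 6 (1980), §1.5.2.
* [Rangarao1993] R. Ranga Rao, Pacific J. Math. 157 (1993), Thm 2.11 p. 344.
* [MoeglinVignerasWaldspurger1987] C. Mœglin, M.-F. Vignéras, J.-L. Waldspurger, LNM 1291 (1987), Chap. 3 §I.3.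
-/

set_option autoImplicit false

noncomputable section

open MeasureTheory
open Literature.LinearAlgebra.QuadraticForm

namespace Literature.NumberTheory.Weil1964

/-! ## §1 Lagrangians under an isometry `e : (V, B) ≃ (V', B')` -/

section Lagrangian

variable {F : Type*} [Field F]
variable {V : Type*} [AddCommGroup V] [Module F V] {V' : Type*} [AddCommGroup V'] [Module F V']
  {B : LinearMap.BilinForm F V} {B' : LinearMap.BilinForm F V'} (e : V ≃ₗ[F] V')
  (hB : ∀ x y : V, B' (e x) (e y) = B x y)

include hB in
/-- the hypothesis read backwards: `B(e⁻¹ x', e⁻¹ y') = B'(x', y')`. [cite: LionVergne1980, §1.5.2] -/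
theorem form_symm_symm_eq (x' y' : V') : B (e.symm x') (e.symm y') = B' x' y' := by
  rw [← hB, LinearEquiv.apply_symm_apply, LinearEquiv.apply_symm_apply]

include hB in
/-- **an isometry maps Lagrangians to Lagrangians**: `(eℓ)^⊥ = eℓ` for `B'` if `ℓ^⊥ = ℓ` for `B`.
[cite: LionVergne1980, §1.1.3–1.1.4, §1.5.2] -/
theorem orthogonal_map_equiv_eq_self {ℓ : Submodule F V} (hℓ : B.orthogonal ℓ = ℓ) :
    B'.orthogonal (ℓ.map (e : V →ₗ[F] V')) = ℓ.map (e : V →ₗ[F] V') := by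
  ext x'
  rw [LinearMap.BilinForm.mem_orthogonal_iff]
  constructor
  · intro h
    have hx : e.symm x' ∈ B.orthogonal ℓ := by
      rw [LinearMap.BilinForm.mem_orthogonal_iff]
      intro y hy
      have h1 := h (e y) (Submodule.mem_map_of_mem hy)
      change B' (e y) x' = 0 at h1
      change B y (e.symm x') = 0
      rw [← e.apply_symm_apply x', hB] at h1
      exact h1
    rw [hℓ] at hx
    exact Submodule.mem_map.2 ⟨e.symm x', hx, e.apply_symm_apply x'⟩
  · intro hx' y' hy'
    obtain ⟨x, hx, rfl⟩ := Submodule.mem_map.1 hx'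
    obtain ⟨y, hy, rfl⟩ := Submodule.mem_map.1 hy'
    have hx2 : x ∈ B.orthogonal ℓ := by rw [hℓ]; exact hx
    rw [LinearMap.BilinForm.mem_orthogonal_iff] at hx2
    have := hx2 y hy
    change B y x = 0 at this
    change B' ((e : V →ₗ[F] V') y) ((e : V →ₗ[F] V') x) = 0
    rw [LinearEquiv.coe_coe, hB]
    exact this

include hB in
/-- `alt`-type consequence used downstream: if `B'(e·, e·) = B` then `e` is an isometry for any forms built
linearly from `B`, e.g. `B'(e x, e y) - B'(e y, e x) = B(x, y) - B(y, x)`. [cite: LionVergne1980, §1.5.2] -/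
theorem sub_flip_map_equiv (x y : V) : B' (e x) (e y) - B' (e y) (e x) = B x y - B y x := by
  rw [hB, hB]

end Lagrangian

/-! ## §2 The Leray–Weil index under an isometry between two spaces -/

section Index

variable {F : Type*} [Field F] [ValuativeRel F] [TopologicalSpace F] [IsNonarchimedeanLocalField F]
variable [MeasurableSpace F] [BorelSpace F] (μ : Measure F) [μ.IsAddHaarMeasure] {ψ : AddChar F Circle}
  [Invertible (2 : F)]
variable {V : Type*} [AddCommGroup V] [Module F V] [FiniteDimensional F V]
  {V' : Type*} [AddCommGroup V'] [Module F V'] [FiniteDimensional F V']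
  {B : LinearMap.BilinForm F V} {B' : LinearMap.BilinForm F V'} (e : V ≃ₗ[F] V')
  (hB : ∀ x y : V, B' (e x) (e y) = B x y)

include hB in
/-- **`μ_ψ(eℓ₁, eℓ₂, eℓ₃) = μ_ψ(ℓ₁, ℓ₂, ℓ₃)`** for an isometry `e : (V, B) ≃ (V', B')`: `e` induces an isometry of
Kashiwara's forms `Q_{ℓ₁,ℓ₂,ℓ₃} ≅ Q'_{eℓ₁,eℓ₂,eℓ₃}`, and isometric forms have the same Weil index.
[cite: LionVergne1980, §1.5.2; Rangarao1993, Thm 2.11 p. 344] -/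
theorem lerayWeilIndex_map_equiv (hψ : ψ.IsContinuousNontrivial) (ℓ₁ ℓ₂ ℓ₃ : Submodule F V) :
    lerayWeilIndex ψ μ B' (ℓ₁.map (e : V →ₗ[F] V')) (ℓ₂.map (e : V →ₗ[F] V')) (ℓ₃.map (e : V →ₗ[F] V')) =
      lerayWeilIndex ψ μ B ℓ₁ ℓ₂ ℓ₃ := by
  set E : (ℓ₁ × ℓ₂ × ℓ₃) ≃ₗ[F]
      (ℓ₁.map (e : V →ₗ[F] V') × ℓ₂.map (e : V →ₗ[F] V') × ℓ₃.map (e : V →ₗ[F] V')) :=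
    (e.submoduleMap ℓ₁).prodCongr ((e.submoduleMap ℓ₂).prodCongr (e.submoduleMap ℓ₃)) with hE
  have hcomp : (kashiwaraForm B' (ℓ₁.map (e : V →ₗ[F] V')) (ℓ₂.map (e : V →ₗ[F] V'))
      (ℓ₃.map (e : V →ₗ[F] V'))).comp (E : _ →ₗ[F] _) = kashiwaraForm B ℓ₁ ℓ₂ ℓ₃ := by
    ext x
    rw [QuadraticMap.comp_apply, kashiwaraForm_apply, kashiwaraForm_apply]
    simp only [hE, LinearEquiv.coe_coe, LinearEquiv.prodCongr_apply, LinearEquiv.submoduleMap_apply, hB]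
  rw [lerayWeilIndex, lerayWeilIndex, ← hcomp, weilIndexSpace_comp_linearEquiv μ hψ]

end Index

/-! ## §3 The Leray cocycle under an isometry between two spaces -/

section Cocycle

variable {F : Type*} [Field F] [ValuativeRel F] [TopologicalSpace F] [IsNonarchimedeanLocalField F]
variable [MeasurableSpace F] [BorelSpace F] (μ : Measure F) [μ.IsAddHaarMeasure] {ψ : AddChar F Circle}
  [Invertible (2 : F)]
variable {V : Type*} [AddCommGroup V] [Module F V] [FiniteDimensional F V]
  {V' : Type*} [AddCommGroup V'] [Module F V'] [FiniteDimensional F V']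
  {B : LinearMap.BilinForm F V} {B' : LinearMap.BilinForm F V'} (e : V ≃ₗ[F] V')
  (hB : ∀ x y : V, B' (e x) (e y) = B x y)

omit [ValuativeRel F] [TopologicalSpace F] [IsNonarchimedeanLocalField F] [MeasurableSpace F] [BorelSpace F]
  [Invertible (2 : F)] [FiniteDimensional F V] [FiniteDimensional F V'] in
/-- `(eℓ)` moved by `e g e⁻¹` is `e(gℓ)`. [cite: LionVergne1980, §1.5.2] -/
theorem map_conj_map (ℓ : Submodule F V) (g : V ≃ₗ[F] V) :
    (ℓ.map (e : V →ₗ[F] V')).map ((e.symm ≪≫ₗ g ≪≫ₗ e : V' ≃ₗ[F] V') : V' →ₗ[F] V') =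
      (ℓ.map (g : V →ₗ[F] V)).map (e : V →ₗ[F] V') := by
  rw [LinearEquiv.coe_trans, LinearEquiv.coe_trans, Submodule.map_comp, Submodule.map_comp,
    ← Submodule.map_comp (e : V →ₗ[F] V') (e.symm : V' →ₗ[F] V), LinearEquiv.symm_comp, Submodule.map_id]

omit [ValuativeRel F] [TopologicalSpace F] [IsNonarchimedeanLocalField F] [MeasurableSpace F] [BorelSpace F]
  [Invertible (2 : F)] [FiniteDimensional F V] [FiniteDimensional F V'] in
/-- conjugation is multiplicative: `e (g₁g₂) e⁻¹ = (e g₁ e⁻¹)(e g₂ e⁻¹)`. [cite: LionVergne1980, §1.5.2] -/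
theorem conj_mul (g₁ g₂ : V ≃ₗ[F] V) :
    (e.symm ≪≫ₗ (g₁ * g₂) ≪≫ₗ e : V' ≃ₗ[F] V') = (e.symm ≪≫ₗ g₁ ≪≫ₗ e) * (e.symm ≪≫ₗ g₂ ≪≫ₗ e) := by
  refine LinearEquiv.ext fun x' => ?_
  simp only [LinearEquiv.trans_apply, LinearEquiv.mul_apply, LinearEquiv.symm_apply_apply]

include hB in
/-- **`c_{eℓ}(e g₁ e⁻¹, e g₂ e⁻¹) = c_ℓ(g₁, g₂)`**: the Leray cocycle of `(V', B', eℓ)` at the conjugates is the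
Leray cocycle of `(V, B, ℓ)`. [cite: MoeglinVignerasWaldspurger1987, Chap. 3 §I.3, remarque b); LionVergne1980, §1.5.2] -/
theorem lerayCocycle_conj (hψ : ψ.IsContinuousNontrivial) (ℓ : Submodule F V) (g₁ g₂ : V ≃ₗ[F] V) :
    lerayCocycle ψ μ B' (ℓ.map (e : V →ₗ[F] V')) (e.symm ≪≫ₗ g₁ ≪≫ₗ e) (e.symm ≪≫ₗ g₂ ≪≫ₗ e) =
      lerayCocycle ψ μ B ℓ g₁ g₂ := by
  rw [lerayCocycle_def, lerayCocycle_def, ← conj_mul, map_conj_map, map_conj_map,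
    lerayWeilIndex_map_equiv μ e hB hψ]

end Cocycle

end Literature.NumberTheory.Weil1964
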